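import Summits.NavierStokesRegularity.NavierStokesRegularity.Theorems.ExtremiserTransienceNearExtremalTransienceExtremiserLiouvilleConstantSpeedLocalisedKKT
import Summits.NavierStokesRegularity.NavierStokesRegularity.Theorems.ExtremiserTransienceNearExtremalTransienceExtremiserLiouvilleNewtonGradientDecay
import Literature.Analysis.FluidPDE.ClassicalLerayProjection
import HarnessLib

/-!
# Crux `ExtremiserTransience.NearExtremalTransience` (stmt-NavierStokesRegularity-21883), line `extremiser_liouville`,
# stub K1b — the LERAY CORRECTOR: localised KKT for the residue object with every compactly supported weight

`--supports stmt-NavierStokesRegularity-21883` (helper).  Author: prover seat `ns-el-k1b` (g5).  Step (ii-b) of the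
axial-truncation attack (`Cruxes/NearExtremalTransience/Lines/extremiser_liouville_k1b_jet.md` §4), completing the chain
`…ConstantSpeedConvexKKT` → `…ConstantSpeedLocalisedKKT` (abstract corrector) → here (concrete corrector):

* `lerayCorrector_bounds` — for `G ∈ C^∞_c(ℝ³;ℝ³)` with `|div G| ≤ A`, `p = π[G] = Γ ∗ div G` (tree `divPotential`) is smooth,
  `‖∇p(y)‖ ≤ A·R + √(∫(div G)²/(4πR))` for every `R > 0` (`…NewtonGradientBound`), `‖D∇p‖` is bounded and `D¹∇p, D²∇p ∈ L²`
  (`…NewtonGradientDecay`: `O((1+|y|)⁻³)`), i.e. `∇p` is an admissible global direction;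
* `firstVariation_smul_ge_leray` — **for a constant-speed extended extremiser `v` (`‖v‖ ≡ M = ‖c‖`, `V = v − c`), EVERY
  `θ ∈ C^∞_c(ℝ³;[0,1])` and every `R > 0`:
  `ℓ(θV) ≥ S·∫⟪ω, D∇π[θV] ω⟫ − κ⋆²·M·Z·W·(A R + √(∫(div θV)²/(4πR)))`, `A ≥ sup|div(θV)| = sup|⟪∇θ, V⟫|`** — the truncated,
  Leray-corrected deviation `V − P[θV]` is an admissible competitor and the convex-set KKT inequality applies to it.

What remains for (N8') is analysis, not plumbing: expand `ℓ(θV)` (`curl(θV) = θω + ∇θ × V`, `D(θV) = θDV + V ⊗ ∇θ`) into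
`3S·S_θ − κ⋆²M²(W Z_θ + Z W_θ) + ∇θ-cross terms`, bound the pressure-Hessian term `S∫⟪ω, D∇π[θV]ω⟫` (`‖D∇π‖_∞` by
`…NewtonGradientBound` with `φ = ∂ div(θV)`), choose `θ = g(ξ)χ_ρ(x_h)` on a jet SEGMENT and optimise `R`; see the record's
EXPECTED YIELD (a lower bound on the jet's spreading rate).

WHAT THIS IS NOT: K1b is NOT proved; nothing here proves NS regularity. [folklore]
-/

noncomputable section

open Set Filter Topology MeasureTheory Metric Function Real
open scoped ENNReal NNReal Topology InnerProductSpace RealInnerProductSpace ContDiff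
open Literature.Analysis.FluidPDE Literature.Analysis

namespace Summit.NavierStokesRegularity.NavierStokesRegularity.Theorems

-- the problem directory repeats the summit name (`NavierStokesRegularity/NavierStokesRegularity`)
set_option linter.dupNamespace false

namespace ExtremiserLiouville

open DepletionLadder.KStar

/-! ## The Leray corrector `∇π[G]` of a test field `G` lies in the global tangent class, with an explicit sup bound -/

section LerayCorrector

variable {G : EuclideanSpace ℝ (Fin 3) → EuclideanSpace ℝ (Fin 3)}

/-- `(1 + t)^{-6}` majorant: `(((1+‖y‖)³)⁻¹)² = (1 + ‖y‖)^(-6 : ℝ)`. [folklore] -/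
theorem inv_pow_three_sq_eq_rpow (y : EuclideanSpace ℝ (Fin 3)) :
    (((1 + ‖y‖) ^ 3)⁻¹) ^ 2 = (1 + ‖y‖) ^ (-(6 : ℝ)) := by
  have h0 : 0 < 1 + ‖y‖ := by positivity
  rw [Real.rpow_neg h0.le, show (6 : ℝ) = ((6 : ℕ) : ℝ) by norm_num, Real.rpow_natCast, inv_pow, ← pow_mul]

/-- A continuous field with `‖f y‖ ≤ C (1+‖y‖)⁻³` is square integrable on `ℝ³` (`6 > 3`). [folklore] -/
theorem lintegral_enorm_sq_lt_top_of_decay {F : Type*} [NormedAddCommGroup F] {f : EuclideanSpace ℝ (Fin 3) → F}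
    (hf : Continuous f) {C : ℝ} (hC : ∀ y, ‖f y‖ ≤ C * ((1 + ‖y‖) ^ 3)⁻¹) :
    ∫⁻ y, ‖f y‖ₑ ^ 2 < ⊤ := by
  refine lintegral_enorm_sq_lt_top_of_integrable_sq hf.aestronglyMeasurable ?_
  have hJ : Integrable fun y : EuclideanSpace ℝ (Fin 3) => (1 + ‖y‖) ^ (-(6 : ℝ)) :=
    integrable_one_add_norm (by rw [finrank_euclideanSpace_fin]; norm_num)
  refine (hJ.const_mul (C ^ 2)).mono' (hf.norm.pow 2).aestronglyMeasurable (Eventually.of_forall fun y => ?_)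
  rw [Real.norm_eq_abs, abs_of_nonneg (sq_nonneg _), ← inv_pow_three_sq_eq_rpow, ← mul_pow]
  have hC0 : 0 ≤ C * ((1 + ‖y‖) ^ 3)⁻¹ := (norm_nonneg _).trans (hC y)
  exact pow_le_pow_left₀ (norm_nonneg _) (hC y) 2

/-- **THE LERAY CORRECTOR OF A TEST FIELD IS AN ADMISSIBLE GLOBAL DIRECTION.**  For `G ∈ C^∞_c(ℝ³;ℝ³)` with `|div G| ≤ A`,
the potential `p = π[G] = Γ ∗ div G` is smooth and its gradient satisfies: `‖∇p(y)‖ ≤ A R + √(∫(div G)²/(4πR))` for every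
`R > 0` (`…NewtonGradientBound`), `‖D∇p‖` bounded, `D¹∇p, D²∇p ∈ L²` (`…NewtonGradientDecay`: `O((1+|y|)⁻³)`). [folklore] -/
theorem lerayCorrector_bounds (hG : ContDiff ℝ ∞ G) (hGc : HasCompactSupport G) {A : ℝ}
    (hA : ∀ x, |VectorCalculus.divergence G x| ≤ A) :
    ContDiff ℝ ∞ (divPotential G) ∧
      (∀ R : ℝ, 0 < R → ∀ y, ‖gradient (divPotential G) y‖ ≤
        A * R + Real.sqrt ((∫ x, VectorCalculus.divergence G x ^ 2) / (4 * π * R))) ∧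
      (∃ Bp : ℝ, ∀ y, ‖fderiv ℝ (gradient (divPotential G)) y‖ ≤ Bp) ∧
      (∫⁻ y, ‖iteratedFDeriv ℝ 1 (gradient (divPotential G)) y‖ₑ ^ 2 < ⊤) ∧
      (∫⁻ y, ‖iteratedFDeriv ℝ 2 (gradient (divPotential G)) y‖ₑ ^ 2 < ⊤) := by
  set φ : EuclideanSpace ℝ (Fin 3) → ℝ := VectorCalculus.divergence G with hφdef
  have hφ : ContDiff ℝ (⊤ : ℕ∞) φ := contDiff_divergence_of_contDiff_top hG
  have hφc : HasCompactSupport φ := hGc.mono' fun x hx => by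
    by_contra h
    exact hx (divergence_eq_zero_of_notMem_tsupport h)
  have hp : ContDiff ℝ ∞ (divPotential G) := contDiff_divPotential hG hGc
  have hpN : divPotential G = fun y => ∫ x, newtonKernel (y - x) * φ x := funext fun y => divPotential_apply G y
  set e := (InnerProductSpace.toDual ℝ (EuclideanSpace ℝ (Fin 3))).symm with he
  have hq_eq : gradient (divPotential G) = e ∘ fderiv ℝ (divPotential G) := rfl
  have hq : ContDiff ℝ ∞ (gradient (divPotential G)) := contDiff_gradient_top hp
  -- (ii) sup bound
  have h2 : ∀ R : ℝ, 0 < R → ∀ y, ‖gradient (divPotential G) y‖ ≤ A * R + Real.sqrt ((∫ x, φ x ^ 2) / (4 * π * R)) := by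
    intro R hR y
    rw [hq_eq]
    show ‖e (fderiv ℝ (divPotential G) y)‖ ≤ _
    rw [LinearIsometryEquiv.norm_map, hpN]
    exact norm_fderiv_newtonPotential_le_of_radius hφ hφc hA hR y
  -- norms of the derivative tower of `q = e ∘ Dp`
  obtain ⟨C₂, hC₂0, hC₂⟩ := exists_norm_fderiv_fderiv_newtonPotential_le hφ hφc
  obtain ⟨C₃, hC₃0, hC₃⟩ := exists_norm_fderiv3_newtonPotential_apply_le hφ hφc
  have hn1 : ∀ y, ‖iteratedFDeriv ℝ 1 (gradient (divPotential G)) y‖ ≤ C₂ * ((1 + ‖y‖) ^ 3)⁻¹ := fun y => by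
    rw [hq_eq, e.norm_iteratedFDeriv_comp_left, ← norm_iteratedFDeriv_fderiv, norm_iteratedFDeriv_zero, hpN]
    exact hC₂ y
  have hn2 : ∀ y, ‖iteratedFDeriv ℝ 2 (gradient (divPotential G)) y‖ ≤ C₃ * ((1 + ‖y‖) ^ 3)⁻¹ := fun y => by
    rw [hq_eq, e.norm_iteratedFDeriv_comp_left, ← norm_iteratedFDeriv_fderiv, hpN]
    refine ContinuousMultilinearMap.opNorm_le_bound (by have := hC₃0; positivity) fun m => ?_
    rw [iteratedFDeriv_one_apply, Fin.prod_univ_one]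
    exact hC₃ y (m 0)
  have hcont1 : Continuous (iteratedFDeriv ℝ 1 (gradient (divPotential G))) := hq.continuous_iteratedFDeriv (by simp)
  have hcont2 : Continuous (iteratedFDeriv ℝ 2 (gradient (divPotential G))) :=
    hq.continuous_iteratedFDeriv (by norm_cast)
  refine ⟨hp, h2, ⟨C₂, fun y => ?_⟩, lintegral_enorm_sq_lt_top_of_decay hcont1 hn1, lintegral_enorm_sq_lt_top_of_decay hcont2 hn2⟩
  have hy : 1 ≤ (1 + ‖y‖) ^ 3 := one_le_pow₀ (by linarith [norm_nonneg y])
  calc ‖fderiv ℝ (gradient (divPotential G)) y‖ = ‖iteratedFDeriv ℝ 1 (gradient (divPotential G)) y‖ := by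
        rw [← norm_iteratedFDeriv_fderiv, norm_iteratedFDeriv_zero]
    _ ≤ C₂ * ((1 + ‖y‖) ^ 3)⁻¹ := hn1 y
    _ ≤ C₂ * 1 := mul_le_mul_of_nonneg_left (inv_le_one_of_one_le₀ hy) hC₂0
    _ = C₂ := mul_one _

end LerayCorrector

/-! ## The localised KKT inequality with the Leray corrector -/

variable {v : EuclideanSpace ℝ (Fin 3) → EuclideanSpace ℝ (Fin 3)} {c : EuclideanSpace ℝ (Fin 3)} {θ : EuclideanSpace ℝ (Fin 3) → ℝ}

/-- **LOCALISED KKT WITH THE LERAY CORRECTOR.**  For a constant-speed extended extremiser `v` (`‖v‖ ≡ M = ‖c‖`, `V = v − c`),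
every weight `θ ∈ C^∞_c(ℝ³;[0,1])`, every bound `A ≥ |div(θV)| = |⟪∇θ, V⟫|` and every `R > 0`, with `p = π[θV] = Γ ∗ div(θV)`:
**`ℓ(θV) ≥ S·∫⟪ω, (D∇p) ω⟫ − κ⋆²·M·Z·W·(A R + √(∫(div θV)²/(4πR)))`**.  (Competitor `u = V − P[θV]`,
`P` = `classicalLerayProj`: solenoidal, in the global class by `lerayCorrector_bounds`, `‖c + u‖ ≤ M + ‖∇p‖_∞`.) [folklore] -/
theorem firstVariation_smul_ge_leray
    (hv : ContDiff ℝ ∞ v) (hdiv : VectorCalculus.IsDivFree v) {M B : ℝ} (hMpos : 0 < M)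
    (hM : ∀ x, ‖v x‖ = M) (hcM : ‖c‖ = M) (hB : ∀ x, ‖fderiv ℝ v x‖ ≤ B)
    (h1 : ∫⁻ x, ‖iteratedFDeriv ℝ 1 v x‖ₑ ^ 2 < ⊤) (h2 : ∫⁻ x, ‖iteratedFDeriv ℝ 2 v x‖ₑ ^ 2 < ⊤)
    (hatt : |∫ x, ⟪curl v x, fderiv ℝ v x (curl v x)⟫| = (sInf {κ : ℝ | (∀ (v : EuclideanSpace ℝ (Fin 3) → EuclideanSpace ℝ (Fin 3)) (M B : ℝ), ContDiff ℝ (⊤ : ℕ∞) v → Literature.Analysis.FluidPDE.VectorCalculus.IsDivFree v → (∀ x, ‖v x‖ ≤ M) → (∀ x, ‖fderiv ℝ v x‖ ≤ B) → (∫⁻ x, ‖iteratedFDeriv ℝ 0 v x‖ₑ ^ 2 < ⊤) → (∫⁻ x, ‖iteratedFDeriv ℝ 1 v x‖ₑ ^ 2 < ⊤) → (∫⁻ x, ‖iteratedFDeriv ℝ 2 v x‖ₑ ^ 2 < ⊤) → |∫ x, ⟪Literature.Analysis.FluidPDE.curl v x, fderiv ℝ v x (Literature.Analysis.FluidPDE.curl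 v x)⟫_ℝ| ≤ κ * M * Real.sqrt (∫ x, ‖Literature.Analysis.FluidPDE.curl v x‖ ^ 2) * Real.sqrt (∫ x, Literature.Analysis.FluidPDE.frobeniusNormSq (fderiv ℝ (Literature.Analysis.FluidPDE.curl v) x)))}) * M * Real.sqrt (∫ x, ‖curl v x‖ ^ 2) * Real.sqrt (∫ x, frobeniusNormSq (fderiv ℝ (curl v) x)))
    (hθ : ContDiff ℝ ∞ θ) (hθc : HasCompactSupport θ) (hθ01 : ∀ x, 0 ≤ θ x ∧ θ x ≤ 1)
    {A : ℝ} (hA : ∀ x, |VectorCalculus.divergence (fun y => θ y • (v y - c)) x| ≤ A) {R : ℝ} (hR : 0 < R) :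
    (∫ x, ⟪curl v x, fderiv ℝ v x (curl v x)⟫) *
        (∫ x, (⟪curl (fun y => θ y • (v y - c)) x, fderiv ℝ v x (curl v x)⟫ +
          ⟪curl v x, fderiv ℝ (fun y => θ y • (v y - c)) x (curl v x)⟫ + ⟪curl v x, fderiv ℝ v x (curl (fun y => θ y • (v y - c)) x)⟫)) -
      (sInf {κ : ℝ | (∀ (v : EuclideanSpace ℝ (Fin 3) → EuclideanSpace ℝ (Fin 3)) (M B : ℝ), ContDiff ℝ (⊤ : ℕ∞) v → Literature.Analysis.FluidPDE.VectorCalculus.IsDivFree v → (∀ x, ‖v x‖ ≤ M) → (∀ x, ‖fderiv ℝ v x‖ ≤ B) → (∫⁻ x, ‖iteratedFDeriv ℝ 0 v x‖ₑ ^ 2 < ⊤) → (∫⁻ x, ‖iteratedFDeriv ℝ 1 v x‖ₑ ^ 2 < ⊤) → (∫⁻ x, ‖iteratedFDeriv ℝ 2 v x‖ₑ ^ 2 < ⊤) → |∫ x, ⟪Literature.Analysis.FluidPDE.curl v x, fderiv ℝ v x (Literature.Analysis.FluidPDE.curl v x)⟫_ℝ| ≤ κ * M * Real.sqrt (∫ x,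 ‖Literature.Analysis.FluidPDE.curl v x‖ ^ 2) * Real.sqrt (∫ x, Literature.Analysis.FluidPDE.frobeniusNormSq (fderiv ℝ (Literature.Analysis.FluidPDE.curl v) x)))}) ^ 2 * M ^ 2 * ((∫ x, frobeniusNormSq (fderiv ℝ (curl v) x)) * (∫ x, ⟪curl v x, curl (fun y => θ y • (v y - c)) x⟫) +
        (∫ x, ‖curl v x‖ ^ 2) * (∫ x, ∑ i, ⟪fderiv ℝ (curl v) x (EuclideanSpace.basisFun (Fin 3) ℝ i), fderiv ℝ (curl (fun y => θ y • (v y - c))) x (EuclideanSpace.basisFun (Fin 3) ℝ i)⟫)) ≥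
      (∫ x, ⟪curl v x, fderiv ℝ v x (curl v x)⟫) *
          (∫ x, ⟪curl v x, fderiv ℝ (gradient (divPotential (fun y => θ y • (v y - c)))) x (curl v x)⟫) -
        (sInf {κ : ℝ | (∀ (v : EuclideanSpace ℝ (Fin 3) → EuclideanSpace ℝ (Fin 3)) (M B : ℝ), ContDiff ℝ (⊤ : ℕ∞) v → Literature.Analysis.FluidPDE.VectorCalculus.IsDivFree v → (∀ x, ‖v x‖ ≤ M) → (∀ x, ‖fderiv ℝ v x‖ ≤ B) → (∫⁻ x, ‖iteratedFDeriv ℝ 0 v x‖ₑ ^ 2 < ⊤) → (∫⁻ x, ‖iteratedFDeriv ℝ 1 v x‖ₑ ^ 2 < ⊤) → (∫⁻ x, ‖iteratedFDeriv ℝ 2 v x‖ₑ ^ 2 < ⊤) → |∫ x, ⟪Literature.Analysis.FluidPDE.curl v x, fderiv ℝ v x (Literature.Analysis.FluidPDE.curl v x)⟫_ℝ| ≤ κ * M * Real.sqrt (∫ x, ‖Literature.Analysis.FluidPDE.curl v x‖ ^ 2) * Real.sqrt (∫ x, Literature.Analysis.FluidPDE.frobeniusNormSq (fderiv ℝ (Literature.Analysis.FluidPDE.curl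 v) x)))}) ^ 2 * M * (∫ x, ‖curl v x‖ ^ 2) * (∫ x, frobeniusNormSq (fderiv ℝ (curl v) x)) *
          (A * R + Real.sqrt ((∫ x, VectorCalculus.divergence (fun y => θ y • (v y - c)) x ^ 2) / (4 * π * R))) := by
  set G : EuclideanSpace ℝ (Fin 3) → EuclideanSpace ℝ (Fin 3) := fun y => θ y • (v y - c) with hGdef
  have hV : ContDiff ℝ ∞ (fun y => v y - c) := hv.sub contDiff_const
  have hG : ContDiff ℝ ∞ G := hθ.smul hV
  have hGc : HasCompactSupport G := hθc.smul_right
  obtain ⟨hp, hη, ⟨Bp, hBp⟩, hp1, hp2⟩ := lerayCorrector_bounds hG hGc hA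
  -- the corrected truncation is `V − P[G]`, hence divergence free
  have hudiv : VectorCalculus.IsDivFree (fun x => (1 - θ x) • (v x - c) + gradient (divPotential G) x) := by
    have e : (fun x => (1 - θ x) • (v x - c) + gradient (divPotential G) x) =
        fun x => (v x - c) + (-1 : ℝ) • classicalLerayProj G x := by
      funext x
      rw [classicalLerayProj_apply]
      simp only [hGdef, sub_smul, one_smul, smul_sub, neg_one_smul]
      abel
    rw [e]
    intro x
    have hVd : Differentiable ℝ (fun y => v y - c) := hV.differentiable (by simp)
    have hPd : Differentiable ℝ (classicalLerayProj G) := (contDiff_classicalLerayProj hG hGc).differentiable (by simp)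
    rw [divergence_add_smul hVd hPd, isDivFree_sub_const hdiv c x, isDivFree_classicalLerayProj hG hGc x, mul_zero, add_zero]
  exact firstVariation_smul_ge_of_gradient_corrector hv hdiv hMpos hM hcM hB h1 h2 hatt hθ hθc hθ01 hp (hη R hR) hBp hp1 hp2 hudiv

end ExtremiserLiouville

end Summit.NavierStokesRegularity.NavierStokesRegularity.Theorems

end
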